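/-
Copyright (c) 2026 the pub-hodgecm-mathlib formalisation cell (harness21).  Prover seat hodgecm-mathlib-LH4-p02 (g12): STAGE 1a «(D-RAM) FOUR-FRAME» squad of
crux H413 (director s1808; heir LEAD F0P3a-plan (g18) T17-27 DIRECTIVE b9ecbbedecc9c5ae; dealer LH4-plan (g10) WORD #6 deal g10-#12 «DATUM AT A WILD CM PLACE»), 2026-09-03:
the bridge from the organ's place binders to the datum-quantified stubs of the sibling line `Cruxes/H413/Lines/F0_P3c_DyRamFourFrame.lean`.
-/
import Literature.NumberTheory.Automorphic.UnitaryThreeFourFrameDefs      -- ★ p854559 (#0a, B-p04 (g61)): sheet token D `IsRamifiedQuadraticDatum σ ϖ d t`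
import Literature.NumberTheory.Automorphic.RamifiedPlaceDifferent          -- ★ p850872 (F0P3a-p06 (g18)): `valued_galAdicCompletionMap_sub_self_eq_of_uniformizer` (τ-independence of `d`); brings ★ `RamifiedPlaceEisensteinBasis` (`valued_toPlace_eq_sq_of_ramified`, `valued_toPlace_ne_exp_neg_one`), ★ `exists_toPlace_eq_of_galAdicCompletionMap_eq`, `galAdicCompletionMap_galAdicCompletionMap_of_smul_eq`, `valued_galAdicCompletionMap`
import HarnessLib

/-!
# (D-RAM) FOUR-FRAME: THE RAMIFIED QUADRATIC DATUM AT A WILD CM PLACE — every uniformiser `ϖ` of `L_w` (`w ∣ v` non-split, `e(w|v) ≠ 1`) carries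
# `IsRamifiedQuadraticDatum σ_w ϖ d t` for a unique `(d, t)` (Serre, *Local Fields* IV §1–§2; Neukirch II §6)

Cell `pub/hodgecm-mathlib` (D-0151), crux H413 = `stmt-HodgeConjecture-24833`; sibling line `Cruxes/H413/Lines/F0_P3c_DyRamFourFrame.lean` (STAGE 1a).  THEOREMS ONLY (no
`def`, no `sorry`, no instance ∕ notation).  Dealer LH4-plan (g10) deal g10-#12: the line's stubs are DATUM-QUANTIFIED (`(ϖ) (_hϖ) (d t : ℕ) (_hD : IsRamifiedQuadraticDatum σ_w ϖ d t)`
after the organ's place binders `L v w hw _he _h2`); the sorry-free §2 composition of the line feeds them through THIS file: from a ramified non-split CM place `w ∣ v`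
(`c • w = w`, `e(w|v) ≠ 1`) and ANY uniformiser `ϖ` of `L_w` it produces the sheet datum for `σ_w = galAdicCompletionMap c hw` — (1) `σ_w` is an involution
(★ `galAdicCompletionMap_galAdicCompletionMap_of_smul_eq`), (2) isometric (★ `valued_galAdicCompletionMap`), (3) `|ϖ| = exp(−1)`, (4) RAMIFIED: a non-zero `σ_w`-fixed `x` is
`ι_w p`, `p ∈ L⁺_v` (★ `exists_toPlace_eq_of_galAdicCompletionMap_eq`), of valuation `|p|_v²` (★ `valued_toPlace_eq_sq_of_ramified`), an EVEN power, (5)–(6) `d ≥ 1` := the exponent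
of `|ϖ − σ_wϖ| ≤ |ϖ|` (non-zero because a uniformiser is never `σ_w`-fixed, ★ `valued_toPlace_ne_exp_neg_one`), (7) `t` := the exponent of `|2|_w` (`2 ≠ 0`, `|2| ≤ 1`) — and
shows `d` does not depend on `ϖ` (★ `valued_galAdicCompletionMap_sub_self_eq_of_uniformizer`: `d` = the different number) nor `t`; `1 ≤ t` (the dyadic fence `|2|_w < 1`)
exactly when `2` is not a unit of `𝒪_w`.
HONEST LABEL: HC_CM is proved only modulo the 7 printed citations (2 remaining: hLiu418 = stmt-HodgeConjecture-24832, h413 = stmt-HodgeConjecture-24833) until rung 0 closes;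
(D-RAM) `stub_DyRamCore` stays PRINT [LanglandsShelstad1989 Thm. p. 484 ∕ Rogawski1990 Prop. 4.9.1 (a)] until the road's END lands; this file moves no registry.

* §1 **`exists_isRamifiedQuadraticDatum_of_placesOver`** (the datum at a wild CM place, any uniformiser).
* §2 **`eq_of_isRamifiedQuadraticDatum_of_placesOver`** (`d` and `t` are unique: independent of the uniformiser), `one_le_t_of_not_isUnit_two`, `valued_two_lt_one_of_one_le`
  (the fence from `1 ≤ t`).
-/

noncomputable section

namespace Summit.HodgeConjecture.HodgeConjecture.Cruxes.H413.F0P3cDyRamWildPlaceDatum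

open scoped Valued WithZero
open NumberField IsDedekindDomain
open Literature.NumberTheory.Automorphic Literature.NumberTheory.Automorphic.UnitaryGroup Literature.NumberTheory.Automorphic.UnitaryThreeFourFrame

/-! ## §1 The datum at a ramified non-split CM place -/

/-- **THE RAMIFIED QUADRATIC DATUM AT A WILD CM PLACE.**  `L` CM, `v` a finite place of `L⁺`, `w ∣ v` with `c • w = w` and `e(w|v) ≠ 1`, `ϖ` ANY uniformiser of `L_w`: then
`IsRamifiedQuadraticDatum σ_w ϖ d t` for `σ_w = galAdicCompletionMap c hw`, `d :=` the exponent of `|ϖ − σ_wϖ|` (`1 ≤ d`; the different number), `t :=` the exponent of `|2|_w`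
— involution, isometry, even valuation of fixed elements (`x = ι_w p`, `|ι_w p| = |p|²`), all ★ by name; no tameness, no parity of `d`. [cite: Serre1979, Ch. IV §1 Prop. 4, Ch. IV §2]
[cite: NeukirchANT1999, Ch. II (6.8)–(6.9)] -/
theorem exists_isRamifiedQuadraticDatum_of_placesOver (L : Type) [Field L] [NumberField L] [IsCMField L] {v : HeightOneSpectrum (𝓞 ↥(maximalRealSubfield L))}
    (w : PlacesOver L v) (hw : IsCMField.complexConj L • w.1 = w.1) (he : v.asIdeal.ramificationIdx' w.1.asIdeal ≠ 1) (ϖ : w.1.adicCompletion L)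
    (hϖ : Valued.v ϖ = WithZero.exp (-1 : ℤ)) :
    ∃ d t : ℕ, IsRamifiedQuadraticDatum (galAdicCompletionMap (L := L) (IsCMField.complexConj L) hw) ϖ d t := by
  have hc1 : IsCMField.complexConj L ≠ 1 := IsCMField.complexConj_ne_one L
  have hσσ : ∀ x : w.1.adicCompletion L, galAdicCompletionMap (L := L) (IsCMField.complexConj L) hw (galAdicCompletionMap (L := L) (IsCMField.complexConj L) hw x) = x :=
    fun x => galAdicCompletionMap_galAdicCompletionMap_of_smul_eq (IsCMField.complexConj L) w hc1 hw x
  have hvσ : ∀ a : w.1.adicCompletion L, Valued.v (galAdicCompletionMap (L := L) (IsCMField.complexConj L) hw a) = Valued.v a :=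
    fun a => valued_galAdicCompletionMap (L := L) (IsCMField.complexConj L) hw a
  -- (4) fixed non-zero elements have even valuation
  have heven : ∀ x : w.1.adicCompletion L, galAdicCompletionMap (L := L) (IsCMField.complexConj L) hw x = x → x ≠ 0 →
      ∃ n : ℤ, Valued.v x = WithZero.exp (2 * n) := by
    intro x hx hx0
    obtain ⟨p, rfl⟩ := exists_toPlace_eq_of_galAdicCompletionMap_eq (IsCMField.complexConj L) w hc1 hw x hx
    have hp0 : Valued.v p ≠ 0 := fun h => by
      apply hx0
      rw [← (Valuation.zero_iff Valued.v), valued_toPlace_eq_sq_of_ramified L v w hw he, h, zero_pow two_ne_zero]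
    refine ⟨WithZero.log (Valued.v p), ?_⟩
    rw [valued_toPlace_eq_sq_of_ramified L v w hw he, ← WithZero.exp_log hp0, pow_two, ← WithZero.exp_add, WithZero.log_exp, two_mul]
  -- (5)–(6) the different exponent `d ≥ 1`
  have hδ0 : ϖ - galAdicCompletionMap (L := L) (IsCMField.complexConj L) hw ϖ ≠ 0 := by
    intro h
    have hfix : galAdicCompletionMap (L := L) (IsCMField.complexConj L) hw ϖ = ϖ := (sub_eq_zero.1 h).symm
    obtain ⟨p, hp⟩ := exists_toPlace_eq_of_galAdicCompletionMap_eq (IsCMField.complexConj L) w hc1 hw ϖ hfix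
    exact valued_toPlace_ne_exp_neg_one L v w hw he p (by rw [hp, hϖ])
  have hvδ0 : Valued.v (ϖ - galAdicCompletionMap (L := L) (IsCMField.complexConj L) hw ϖ) ≠ 0 := (Valuation.ne_zero_iff _).2 hδ0
  obtain ⟨k, hk⟩ : ∃ k : ℤ, Valued.v (ϖ - galAdicCompletionMap (L := L) (IsCMField.complexConj L) hw ϖ) = WithZero.exp k := ⟨_, (WithZero.exp_log hvδ0).symm⟩
  have hk1 : k ≤ -1 := by
    have hle : Valued.v (ϖ - galAdicCompletionMap (L := L) (IsCMField.complexConj L) hw ϖ) ≤ WithZero.exp (-1 : ℤ) :=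
      (Valuation.map_sub _ _ _).trans (max_le hϖ.le (by rw [hvσ, hϖ]))
    rw [hk, WithZero.exp_le_exp] at hle; exact hle
  obtain ⟨d, hd⟩ : ∃ d : ℕ, (d : ℤ) = -k := ⟨(-k).toNat, by omega⟩
  -- (7) the exponent `t` of `|2|`
  have h20 : (2 : w.1.adicCompletion L) ≠ 0 := by
    rw [show (2 : w.1.adicCompletion L) = algebraMap L (w.1.adicCompletion L) 2 by rw [map_ofNat]]
    exact (_root_.map_ne_zero (algebraMap L (w.1.adicCompletion L))).2 two_ne_zero
  have hv20 : Valued.v (2 : w.1.adicCompletion L) ≠ 0 := (Valuation.ne_zero_iff _).2 h20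
  obtain ⟨k', hk'⟩ : ∃ k' : ℤ, Valued.v (2 : w.1.adicCompletion L) = WithZero.exp k' := ⟨_, (WithZero.exp_log hv20).symm⟩
  have hk'0 : k' ≤ 0 := by
    have hle : Valued.v (2 : w.1.adicCompletion L) ≤ 1 := by
      rw [show (2 : w.1.adicCompletion L) = 1 + 1 by norm_num]; exact (Valuation.map_add _ _ _).trans (by rw [map_one, max_self])
    rw [hk', ← WithZero.exp_zero, WithZero.exp_le_exp] at hle; exact hle
  obtain ⟨t, ht⟩ : ∃ t : ℕ, (t : ℤ) = -k' := ⟨(-k').toNat, by omega⟩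
  refine ⟨d, t, hσσ, hvσ, hϖ, heven, ?_, by omega, ?_⟩
  · rw [hk, hϖ, ← WithZero.exp_nsmul, nsmul_eq_mul]; congr 1; omega
  · rw [hk', hϖ, ← WithZero.exp_nsmul, nsmul_eq_mul]; congr 1; omega

/-! ## §2 Uniqueness of `(d, t)` and the dyadic fence -/

/-- **`d` AND `t` DO NOT DEPEND ON THE UNIFORMISER**: two data `IsRamifiedQuadraticDatum σ_w ϖ d t`, `IsRamifiedQuadraticDatum σ_w ϖ′ d′ t′` at the same ramified non-split CM place
have `d = d′` (★ `valued_galAdicCompletionMap_sub_self_eq_of_uniformizer`: `|σ_wϖ′ − ϖ′| = |σ_wϖ − ϖ|` is the different number) and `t = t′` (`|2|_w`).  This identifies the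
datum-quantified level `mstarOfRecord d` of the line's stubs with the line's `MstarFn L v w`. [cite: Serre1979, Ch. IV §1 Prop. 4] [cite: Serre1979, Ch. III §6 Cor. 2] -/
theorem eq_of_isRamifiedQuadraticDatum_of_placesOver (L : Type) [Field L] [NumberField L] [IsCMField L] {v : HeightOneSpectrum (𝓞 ↥(maximalRealSubfield L))}
    (w : PlacesOver L v) (hw : IsCMField.complexConj L • w.1 = w.1) (he : v.asIdeal.ramificationIdx' w.1.asIdeal ≠ 1) {ϖ ϖ' : w.1.adicCompletion L} {d d' t t' : ℕ}
    (hD : IsRamifiedQuadraticDatum (galAdicCompletionMap (L := L) (IsCMField.complexConj L) hw) ϖ d t)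
    (hD' : IsRamifiedQuadraticDatum (galAdicCompletionMap (L := L) (IsCMField.complexConj L) hw) ϖ' d' t') : d = d' ∧ t = t' := by
  obtain ⟨-, -, hϖ, -, hd, -, h2⟩ := hD
  obtain ⟨-, -, hϖ', -, hd', -, h2'⟩ := hD'
  have hinj : ∀ m n : ℕ, WithZero.exp (-1 : ℤ) ^ m = WithZero.exp (-1 : ℤ) ^ n → m = n := fun m n h => by
    rw [← WithZero.exp_nsmul, ← WithZero.exp_nsmul, WithZero.exp_inj, nsmul_eq_mul, nsmul_eq_mul] at h
    omega
  refine ⟨hinj d d' ?_, hinj t t' ?_⟩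
  · rw [← hϖ, ← hd, Valuation.map_sub_swap, ← valued_galAdicCompletionMap_sub_self_eq_of_uniformizer L v w hw he hϖ hϖ', ← Valuation.map_sub_swap, hd', hϖ', hϖ]
  · rw [← hϖ, ← h2, h2', hϖ', hϖ]

/-- **`1 ≤ t` WHEN `2` IS NOT A UNIT OF `𝒪`** (the dyadic places): `|2| = |ϖ|^t` with `|2| ≠ 1` forces `t ≠ 0`.  (Any field `K` with the sheet datum.) [cite: Serre1979, Ch. IV §2] -/
theorem one_le_t_of_not_isUnit_two {K : Type} [Field K] [Valued K ℤᵐ⁰] {σ : K →+* K} {ϖ : K} {d t : ℕ} (h2 : ¬ IsUnit (2 : 𝒪[K]))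
    (hD : IsRamifiedQuadraticDatum σ ϖ d t) : 1 ≤ t := by
  obtain ⟨-, -, -, -, -, -, h2t⟩ := hD
  by_contra ht
  have ht0 : t = 0 := by omega
  apply h2
  rw [CartanUnique.isUnit_integer_iff]
  change Valued.v (2 : K) = 1
  rw [h2t, ht0, pow_zero]

/-- **THE DYADIC FENCE FROM `1 ≤ t`**: `IsRamifiedQuadraticDatum σ ϖ d t` with `1 ≤ t` gives `|2| < 1` (`|2| = |ϖ|^t ≤ |ϖ| < 1`).  (Any field `K`.) [cite: Serre1979, Ch. IV §2] -/
theorem valued_two_lt_one_of_one_le {K : Type} [Field K] [Valued K ℤᵐ⁰] {σ : K →+* K} {ϖ : K} {d t : ℕ} (hD : IsRamifiedQuadraticDatum σ ϖ d t) (ht : 1 ≤ t) :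
    Valued.v (2 : K) < 1 := by
  obtain ⟨-, -, hϖ, -, -, -, h2t⟩ := hD
  have hϖ1 : Valued.v ϖ < 1 := by rw [hϖ, ← WithZero.exp_zero, WithZero.exp_lt_exp]; omega
  rw [h2t]
  exact pow_lt_one' hϖ1 (by omega)

end Summit.HodgeConjecture.HodgeConjecture.Cruxes.H413.F0P3cDyRamWildPlaceDatum

end
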